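import Mathlib.Combinatorics.Hall.Basic
import Mathlib.Logic.Equiv.Basic
import HarnessLib

/-!
# Upward (dominating) bijections of set families: Hall form, cancellation, duality (support file)

Support file (prover seat `prim-bnk-2`, gen 31; `--supports stmt-CriticalPhenomena-4575`).  Memo:
`run/shared/lean/prim/prim-l12/FROM-prim-bnk-2-g31-COMPRESSION-THEOREM.md` §3, §5.

The bookkeeping of SCHEME Σ (prim-bnk-2 g30, `FROM-prim-bnk-2-g30-ONE-SHARED-SCHEME.md` §3: THEOREM Σ + LEMMA I** + LEMMA J** ⟹
THEOREM I₁ = CONJ V for one-shared-coordinate pairs) is written in the calculus of *upward bijections* `X ≅↑ Y` between finite set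
families: a bijection `e : X ≃ Y` with `x ⊆ e x`.  This file supplies that calculus, so that the outputs of LEMMA I**
(`twoLevel_kleitmanHall`: `A ≅↑ Q \ P`, `σQ \ A ≅↑ P`) can be converted into the forms Σ consumes
(`c ≅↑ d \ T`, `σΔ ≅↑ T`, `a \ a* ≅↑ b`, memo g31 §0/§3) by pure bookkeeping:

* `card_eq_and_hall_of_exists_dominating_equiv` / `exists_dominating_equiv_of_hall`: `X ≅↑ Y` iff `|X| = |Y|` and Hall's
  condition `|S| ≤ |{y ∈ Y : ∃ x ∈ S, x ⊆ y}|` for all `S ⊆ X` (Hall's marriage theorem, Mathlib);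
* `exists_dominating_equiv_sdiff` (cancellation): `X ≅↑ Y ⟹ X \ Y ≅↑ Y \ X`;
* `exists_dominating_equiv_image_sdiff` (σ-duality in a cube `R`): `X ≅↑ Y ⟹ σ_R Y ≅↑ σ_R X`;
* `exists_dominating_equiv_union` (gluing along disjoint pieces).

No definitions; no `sorry`; standard axioms.
-/

namespace Summit.CriticalPhenomena.PercolationContinuityZ3.Theorems

namespace SahiFComb.Shift

open Finset

variable {α : Type*} [DecidableEq α]

/-! ### 1. Hall form -/

/-- An upward bijection forces equal sizes and Hall's condition. [folklore] -/
theorem card_eq_and_hall_of_exists_dominating_equiv {X Y : Finset (Finset α)}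
    (h : ∃ e : ↥X ≃ ↥Y, ∀ x : ↥X, (x : Finset α) ⊆ (e x : Finset α)) :
    #X = #Y ∧ ∀ S ⊆ X, #S ≤ #{y ∈ Y | ∃ x ∈ S, x ⊆ y} := by
  obtain ⟨e, he⟩ := h
  refine ⟨?_, fun S hS => ?_⟩
  · rw [← Fintype.card_coe X, ← Fintype.card_coe Y]
    exact Fintype.card_congr e
  · let f : Finset α → Finset α := fun s => if hs : s ∈ X then (e ⟨s, hs⟩ : Finset α) else s
    have hf : ∀ s (hs : s ∈ X), f s = (e ⟨s, hs⟩ : Finset α) := fun s hs => by simp only [f, dif_pos hs]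
    refine card_le_card_of_injOn f (fun s hs => ?_) (fun s hs s' hs' hss' => ?_)
    · have hsX : s ∈ X := hS hs
      rw [mem_coe, mem_filter, hf s hsX]
      exact ⟨(e ⟨s, hsX⟩).2, s, hs, he ⟨s, hsX⟩⟩
    · have hsX : s ∈ X := hS hs
      have hs'X : s' ∈ X := hS hs'
      have h1 : f s = f s' := hss'
      rw [hf s hsX, hf s' hs'X] at h1
      have h2 : e ⟨s, hsX⟩ = e ⟨s', hs'X⟩ := Subtype.ext h1
      exact congrArg Subtype.val (e.injective h2)

/-- **Hall's theorem, upward-bijection form.**  Equal sizes and Hall's condition give a bijection `e : X ≃ Y` with `x ⊆ e x`.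
[folklore; Mathlib `Finset.all_card_le_biUnion_card_iff_exists_injective`] -/
theorem exists_dominating_equiv_of_hall {X Y : Finset (Finset α)} (hcard : #X = #Y)
    (hall : ∀ S ⊆ X, #S ≤ #{y ∈ Y | ∃ x ∈ S, x ⊆ y}) :
    ∃ e : ↥X ≃ ↥Y, ∀ x : ↥X, (x : Finset α) ⊆ (e x : Finset α) := by
  classical
  set t : ↥X → Finset (Finset α) := fun x => {y ∈ Y | (x : Finset α) ⊆ y} with ht
  have hH : ∀ A : Finset ↥X, #A ≤ #(A.biUnion t) := by
    intro A
    have hsub : A.map (Function.Embedding.subtype (· ∈ X)) ⊆ X := fun s hs => by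
      obtain ⟨x, -, rfl⟩ := mem_map.1 hs
      exact x.2
    have h1 := hall _ hsub
    rw [card_map] at h1
    refine h1.trans (card_le_card fun y hy => ?_)
    rw [mem_filter] at hy
    obtain ⟨hyY, x, hx, hxy⟩ := hy
    obtain ⟨x', hx'A, rfl⟩ := mem_map.1 hx
    exact mem_biUnion.2 ⟨x', hx'A, mem_filter.2 ⟨hyY, hxy⟩⟩
  obtain ⟨f, hf_inj, hf_mem⟩ := (all_card_le_biUnion_card_iff_exists_injective t).1 hH
  let g : ↥X → ↥Y := fun x => ⟨f x, (mem_filter.1 (hf_mem x)).1⟩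
  have hg_inj : Function.Injective g := fun a b hab => hf_inj (congrArg Subtype.val hab)
  have hg_bij : Function.Bijective g := by
    rw [Fintype.bijective_iff_injective_and_card]
    exact ⟨hg_inj, by rw [Fintype.card_coe, Fintype.card_coe, hcard]⟩
  exact ⟨Equiv.ofBijective g hg_bij, fun x => (mem_filter.1 (hf_mem x)).2⟩

/-! ### 2. Cancellation of the common part -/

/-- **Cancellation.**  If `X ≅↑ Y` then `X \ Y ≅↑ Y \ X`: the common members can be struck from both sides (in Hall form,
enlarge a test set `S ⊆ X \ Y` by the common members above it). [folklore] -/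
theorem exists_dominating_equiv_sdiff {X Y : Finset (Finset α)}
    (h : ∃ e : ↥X ≃ ↥Y, ∀ x : ↥X, (x : Finset α) ⊆ (e x : Finset α)) :
    ∃ e : ↥(X \ Y) ≃ ↥(Y \ X), ∀ x : ↥(X \ Y), (x : Finset α) ⊆ (e x : Finset α) := by
  obtain ⟨hcard, hall⟩ := card_eq_and_hall_of_exists_dominating_equiv h
  refine exists_dominating_equiv_of_hall ?_ fun S hS => ?_
  · have h1 := card_sdiff_add_card_inter X Y
    have h2 := card_sdiff_add_card_inter Y X
    rw [inter_comm] at h2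
    omega
  · -- the common members above `S`
    set Z : Finset (Finset α) := {z ∈ X ∩ Y | ∃ x ∈ S, x ⊆ z} with hZ
    have hSX : S ⊆ X := fun s hs => (mem_sdiff.1 (hS hs)).1
    have hZX : Z ⊆ X := fun z hz => (mem_inter.1 (mem_filter.1 hz).1).1
    have hdisj : Disjoint S Z := disjoint_left.2 fun s hsS hsZ =>
      (mem_sdiff.1 (hS hsS)).2 (mem_inter.1 (mem_filter.1 hsZ).1).2
    have h1 := hall (S ∪ Z) (union_subset hSX hZX)
    rw [card_union_of_disjoint hdisj] at h1
    -- neighbourhoods: `N_Y(S ∪ Z) = N_{Y \ X}(S) ⊔ Z`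
    have hN : ({y ∈ Y | ∃ x ∈ S ∪ Z, x ⊆ y} : Finset (Finset α)) = {y ∈ Y \ X | ∃ x ∈ S, x ⊆ y} ∪ Z := by
      ext y
      simp only [mem_filter, mem_union, mem_sdiff, hZ, mem_inter]
      constructor
      · rintro ⟨hyY, x, hx, hxy⟩
        have hxS : ∃ x' ∈ S, x' ⊆ y := by
          rcases hx with hx | hx
          · exact ⟨x, hx, hxy⟩
          · obtain ⟨-, x', hx'S, hx'x⟩ := hx
            exact ⟨x', hx'S, hx'x.trans hxy⟩
        by_cases hyX : y ∈ X
        · exact Or.inr ⟨⟨hyX, hyY⟩, hxS⟩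
        · exact Or.inl ⟨⟨hyY, hyX⟩, hxS⟩
      · rintro (⟨⟨hyY, -⟩, x, hxS, hxy⟩ | ⟨⟨-, hyY⟩, x, hxS, hxy⟩)
        · exact ⟨hyY, x, Or.inl hxS, hxy⟩
        · exact ⟨hyY, x, Or.inl hxS, hxy⟩
    rw [hN] at h1
    have h2 := (card_union_le ({y ∈ Y \ X | ∃ x ∈ S, x ⊆ y} : Finset (Finset α)) Z)
    omega

/-! ### 3. Duality and gluing -/

/-- **σ-duality inside a cube `R`.**  If `X ≅↑ Y` for families of subsets of `R`, then `σ_R Y ≅↑ σ_R X`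
(`σ_R s = R \ s`). [folklore] -/
theorem exists_dominating_equiv_image_sdiff (R : Finset α) {X Y : Finset (Finset α)}
    (hX : ∀ s ∈ X, s ⊆ R) (hY : ∀ s ∈ Y, s ⊆ R)
    (h : ∃ e : ↥X ≃ ↥Y, ∀ x : ↥X, (x : Finset α) ⊆ (e x : Finset α)) :
    ∃ e : ↥(Y.image fun s => R \ s) ≃ ↥(X.image fun s => R \ s),
      ∀ y : ↥(Y.image fun s => R \ s), (y : Finset α) ⊆ (e y : Finset α) := by
  obtain ⟨e, he⟩ := h
  -- `σ_R` is an involution on the subsets of `R`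
  have hinv : ∀ s ⊆ R, R \ (R \ s) = s := fun s hs => by
    rw [sdiff_sdiff_right_self, inf_eq_inter, inter_eq_right.2 hs]
  have hmemY : ∀ s, s ∈ Y.image (fun s => R \ s) → R \ s ∈ Y := by
    intro s hs
    obtain ⟨t, ht, rfl⟩ := mem_image.1 hs
    rwa [hinv t (hY t ht)]
  have hsubY : ∀ s, s ∈ Y.image (fun s => R \ s) → s ⊆ R := by
    intro s hs
    obtain ⟨t, -, rfl⟩ := mem_image.1 hs
    exact sdiff_subset
  -- the dual map `y ↦ σ (e⁻¹ (σ y))`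
  let g : ↥(Y.image fun s => R \ s) → ↥(X.image fun s => R \ s) := fun y =>
    ⟨R \ (e.symm ⟨R \ (y : Finset α), hmemY y.1 y.2⟩ : Finset α),
      mem_image_of_mem _ (e.symm ⟨R \ (y : Finset α), hmemY y.1 y.2⟩).2⟩
  have hg_inj : Function.Injective g := by
    intro y₁ y₂ hy
    have h1 : R \ (e.symm ⟨R \ (y₁ : Finset α), hmemY y₁.1 y₁.2⟩ : Finset α) =
        R \ (e.symm ⟨R \ (y₂ : Finset α), hmemY y₂.1 y₂.2⟩ : Finset α) := congrArg Subtype.val hy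
    have h2 : (e.symm ⟨R \ (y₁ : Finset α), hmemY y₁.1 y₁.2⟩ : Finset α) =
        (e.symm ⟨R \ (y₂ : Finset α), hmemY y₂.1 y₂.2⟩ : Finset α) := by
      rw [← hinv _ (hX _ (e.symm ⟨R \ (y₁ : Finset α), hmemY y₁.1 y₁.2⟩).2), h1,
        hinv _ (hX _ (e.symm ⟨R \ (y₂ : Finset α), hmemY y₂.1 y₂.2⟩).2)]
    have h3 := e.symm.injective (Subtype.ext h2)
    have h4 : R \ (y₁ : Finset α) = R \ (y₂ : Finset α) := congrArg Subtype.val h3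
    apply Subtype.ext
    rw [← hinv _ (hsubY y₁.1 y₁.2), h4, hinv _ (hsubY y₂.1 y₂.2)]
  have hcard : Fintype.card ↥(Y.image fun s => R \ s) = Fintype.card ↥(X.image fun s => R \ s) := by
    have hiX : Set.InjOn (fun s => R \ s) (X : Set (Finset α)) := fun s hs t ht hst => by
      rw [← hinv s (hX s hs), ← hinv t (hX t ht)]
      exact congrArg (fun u => R \ u) hst
    have hiY : Set.InjOn (fun s => R \ s) (Y : Set (Finset α)) := fun s hs t ht hst => by
      rw [← hinv s (hY s hs), ← hinv t (hY t ht)]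
      exact congrArg (fun u => R \ u) hst
    rw [Fintype.card_coe, Fintype.card_coe, card_image_of_injOn hiX, card_image_of_injOn hiY,
      ← Fintype.card_coe X, ← Fintype.card_coe Y]
    exact (Fintype.card_congr e).symm
  have hg_bij : Function.Bijective g := by
    rw [Fintype.bijective_iff_injective_and_card]
    exact ⟨hg_inj, hcard⟩
  refine ⟨Equiv.ofBijective g hg_bij, fun y => ?_⟩
  -- domination: `x ⊆ e x = σ y` gives `y ⊆ σ x`
  show (y : Finset α) ⊆ R \ (e.symm ⟨R \ (y : Finset α), hmemY y.1 y.2⟩ : Finset α)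
  have h1 := he (e.symm ⟨R \ (y : Finset α), hmemY y.1 y.2⟩)
  rw [Equiv.apply_symm_apply] at h1
  -- h1 : x ⊆ R \ y  with x := e.symm (σ y)
  intro a ha
  rw [mem_sdiff]
  refine ⟨hsubY y.1 y.2 ha, fun hax => ?_⟩
  exact (mem_sdiff.1 (h1 hax)).2 ha

/-- **Gluing.**  Upward bijections on disjoint pieces combine: `X₁ ≅↑ Y₁`, `X₂ ≅↑ Y₂`, `X₁ ∩ X₂ = ∅ = Y₁ ∩ Y₂`
`⟹ X₁ ∪ X₂ ≅↑ Y₁ ∪ Y₂`. [folklore] -/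
theorem exists_dominating_equiv_union {X₁ X₂ Y₁ Y₂ : Finset (Finset α)} (hX : Disjoint X₁ X₂) (hY : Disjoint Y₁ Y₂)
    (h₁ : ∃ e : ↥X₁ ≃ ↥Y₁, ∀ x : ↥X₁, (x : Finset α) ⊆ (e x : Finset α))
    (h₂ : ∃ e : ↥X₂ ≃ ↥Y₂, ∀ x : ↥X₂, (x : Finset α) ⊆ (e x : Finset α)) :
    ∃ e : ↥(X₁ ∪ X₂) ≃ ↥(Y₁ ∪ Y₂), ∀ x : ↥(X₁ ∪ X₂), (x : Finset α) ⊆ (e x : Finset α) := by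
  obtain ⟨hc₁, hall₁⟩ := card_eq_and_hall_of_exists_dominating_equiv h₁
  obtain ⟨hc₂, hall₂⟩ := card_eq_and_hall_of_exists_dominating_equiv h₂
  refine exists_dominating_equiv_of_hall ?_ fun S hS => ?_
  · rw [card_union_of_disjoint hX, card_union_of_disjoint hY, hc₁, hc₂]
  · have e1 := hall₁ (S ∩ X₁) inter_subset_right
    have e2 := hall₂ (S ∩ X₂) inter_subset_right
    have hS12 : S = S ∩ X₁ ∪ S ∩ X₂ := by rw [← inter_union_distrib_left, inter_eq_left.2 hS]
    have hdS : Disjoint (S ∩ X₁) (S ∩ X₂) :=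
      disjoint_of_subset_left inter_subset_right (disjoint_of_subset_right inter_subset_right hX)
    have hsub : ({y ∈ Y₁ | ∃ x ∈ S ∩ X₁, x ⊆ y} : Finset (Finset α)) ∪ {y ∈ Y₂ | ∃ x ∈ S ∩ X₂, x ⊆ y} ⊆
        {y ∈ Y₁ ∪ Y₂ | ∃ x ∈ S, x ⊆ y} := by
      intro y hy
      rw [mem_filter, mem_union]
      rcases mem_union.1 hy with hy | hy
      · obtain ⟨hyY, x, hx, hxy⟩ := mem_filter.1 hy
        exact ⟨Or.inl hyY, x, (mem_inter.1 hx).1, hxy⟩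
      · obtain ⟨hyY, x, hx, hxy⟩ := mem_filter.1 hy
        exact ⟨Or.inr hyY, x, (mem_inter.1 hx).1, hxy⟩
    have hdN : Disjoint ({y ∈ Y₁ | ∃ x ∈ S ∩ X₁, x ⊆ y} : Finset (Finset α)) {y ∈ Y₂ | ∃ x ∈ S ∩ X₂, x ⊆ y} :=
      disjoint_of_subset_left (filter_subset _ _) (disjoint_of_subset_right (filter_subset _ _) hY)
    calc #S = #(S ∩ X₁) + #(S ∩ X₂) := by rw [← card_union_of_disjoint hdS, ← hS12]
      _ ≤ #({y ∈ Y₁ | ∃ x ∈ S ∩ X₁, x ⊆ y} : Finset (Finset α)) + #{y ∈ Y₂ | ∃ x ∈ S ∩ X₂, x ⊆ y} :=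
          Nat.add_le_add e1 e2
      _ = #(({y ∈ Y₁ | ∃ x ∈ S ∩ X₁, x ⊆ y} : Finset (Finset α)) ∪ {y ∈ Y₂ | ∃ x ∈ S ∩ X₂, x ⊆ y}) :=
          (card_union_of_disjoint hdN).symm
      _ ≤ #{y ∈ Y₁ ∪ Y₂ | ∃ x ∈ S, x ⊆ y} := card_le_card hsub

end SahiFComb.Shift

end Summit.CriticalPhenomena.PercolationContinuityZ3.Theorems
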